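import Mathlib
import HarnessLib
import Literature.Analysis.FluidPDE.VectorCalculus
import Literature.Analysis.FluidPDE.TaoEnstrophyLocalisation
import Summits.NavierStokesRegularity.NavierStokesRegularity.Theorems.ChiralWindowDoorDefs
import Summits.NavierStokesRegularity.NavierStokesRegularity.Theorems.ChiralWindowDoorLambda

/-!
# Door S20 «ChiralWindowDoor» — `curl` COMMUTES with `Λ = (−Δ)^{1/2}` on `C³_b` fields; the vorticity of a chiral
# field is chiral (the input of B2′ in nsreg-p1's R19-LINE)

Door S20 of nsreg-p1's local Type-I door family (`HOME/ns-regularity-ideate-p1/r19/R19-LINE.md` §B2′: «chirality of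
`ω`: `curl ω = Λω` follows from `curl v = Λv` by applying curl — `Λ` commutes with derivatives; one more stub-level
lemma»; DESIGN-ONLY, route NOT born).  For the substrate's second-difference form
`Λ f (x) = ½ ∫ lamK z • (2f(x) − f(x+z) − f(x−z)) dz` this is differentiation under the integral sign: for `f` of class
`C³` with bounded derivatives of orders `0…3`, the `x`-derivative of the integrand, `lamK z • (2Df(x) − Df(x+z) − Df(x−z))`,
has the `x`-uniform integrable majorant of `…ChiralWindowDoorLambda` (second differences of `Df` are quadratic, `Df`
is bounded), so `D(Λf)(x) = ½ ∫ lamK z • (2Df(x) − Df(x+z) − Df(x−z)) dz` (Mathlib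
`hasFDerivAt_integral_of_dominated_of_fderiv_le`), and `curl = curlCLM ∘ D` passes through the Bochner integral
(`ContinuousLinearMap.integral_comp_comm`).

* `exists_majorant_secondDiff_general` — the uniform majorant for functions with values in any real normed space;
* `norm_secondDiff_fderiv_le` — second differences of `Df` are `≤ 2‖D³f‖_∞‖z‖²` (through the evaluations `x ↦ Df(x)v`,
  avoiding triply nested operator norms);
* `hasFDerivAt_fracLapHalf` — **`Λ f` is differentiable with `D(Λ f) = Λ(Df)` (integral form)**;
* `curl_fracLapHalf` — **`curl (Λ f) = Λ (curl f)`**;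
* `isChiral_curl` — **a chiral `C³_b` field has chiral vorticity: `curl v = Λ v ⇒ curl (curl v) = Λ (curl v)`.**

Seat nsreg-p6 g11 (THEOREMS-ONLY door sequels, DIRECTOR-NS g8 #32 (2)/#36).  WHAT THIS IS NOT: not NS regularity
(Clay A); not B2′ (the time-integrated dissipation bookkeeping remains); no route is opened.
-/

noncomputable section

-- the summit and its single sub-problem share the name (CONVENTIONS §1), as in every Theorems file
set_option linter.dupNamespace false

namespace Summit.NavierStokesRegularity.NavierStokesRegularity.Theorems.ChiralWindowDoorCurlCommutes

open MeasureTheory Set Filter Topology Metric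
open scoped RealInnerProductSpace
open Literature.Analysis Literature.Analysis.FluidPDE
open Summit.NavierStokesRegularity.NavierStokesRegularity.Theorems.ChiralWindowDoorDefs
open Summit.NavierStokesRegularity.NavierStokesRegularity.Theorems.ChiralWindowDoorLambda

/-! ### A uniform majorant for second differences with values in a general normed space -/

/-- The `x`-uniform integrable majorant of `lamK z · ‖2φ(x) − φ(x+z) − φ(x−z)‖` for a bounded `φ` with quadratic second
differences, values in any real normed space (near field `π⁻²B₂‖z‖⁻²`, far field `4B₀ · lamKTrunc ½`). -/
theorem exists_majorant_secondDiff_general {F : Type*} [NormedAddCommGroup F] [NormedSpace ℝ F]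
    {φ : EuclideanSpace ℝ (Fin 3) → F} {B₀ B₂ : ℝ} (h0 : ∀ x, ‖φ x‖ ≤ B₀)
    (h2 : ∀ x z, ‖(2 : ℝ) • φ x - φ (x + z) - φ (x - z)‖ ≤ B₂ * ‖z‖ ^ 2) :
    ∃ g : EuclideanSpace ℝ (Fin 3) → ℝ, Integrable g ∧
      ∀ x z, lamK z * ‖(2 : ℝ) • φ x - φ (x + z) - φ (x - z)‖ ≤ g z := by
  have hB₀ : 0 ≤ B₀ := (norm_nonneg _).trans (h0 0)
  have hB₂ : 0 ≤ B₂ := by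
    by_contra h
    push Not at h
    obtain ⟨z, hz⟩ : ∃ z : EuclideanSpace ℝ (Fin 3), z ≠ 0 := exists_ne 0
    have h1 := h2 0 z
    have : B₂ * ‖z‖ ^ 2 < 0 := mul_neg_of_neg_of_pos h (by positivity)
    linarith [norm_nonneg ((2 : ℝ) • φ 0 - φ (0 + z) - φ (0 - z))]
  refine ⟨fun z => (ball (0 : EuclideanSpace ℝ (Fin 3)) 1).indicator
      (fun z => (1 / Real.pi ^ 2 * B₂) * ‖z‖ ^ (-(2 : ℝ))) z + 4 * B₀ * lamKTrunc (1 / 2) z, ?_, ?_⟩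
  · refine Integrable.add ?_ ((integrable_lamKTrunc (by norm_num : (0 : ℝ) < 1 / 2)).const_mul _)
    refine IntegrableOn.integrable_indicator ?_ measurableSet_ball
    have hmeas : Measurable fun z : EuclideanSpace ℝ (Fin 3) => (1 / Real.pi ^ 2 * B₂) * ‖z‖ ^ (-(2 : ℝ)) :=
      Measurable.const_mul (continuous_norm.measurable.pow_const _) _
    exact integrableOn_ball_of_norm_le_rpow (E := EuclideanSpace ℝ (Fin 3)) (F := ℝ) (μ := volume)
      (f := fun z => (1 / Real.pi ^ 2 * B₂) * ‖z‖ ^ (-(2 : ℝ)))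
      (by rw [finrank_euclideanSpace_fin]; norm_num) (C := 1 / Real.pi ^ 2 * B₂) (α := 2) (r := 1)
      (by rw [finrank_euclideanSpace_fin]; norm_num)
      (ae_of_all _ fun z => by rw [Real.norm_eq_abs, abs_of_nonneg (by positivity)])
      hmeas.aestronglyMeasurable
  · intro x z
    dsimp only
    by_cases hz : z ∈ ball (0 : EuclideanSpace ℝ (Fin 3)) 1
    · rw [indicator_of_mem hz]
      have h1 : lamK z * ‖(2 : ℝ) • φ x - φ (x + z) - φ (x - z)‖ ≤ (1 / Real.pi ^ 2 * B₂) * ‖z‖ ^ (-(2 : ℝ)) :=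
        (mul_le_mul_of_nonneg_left (h2 x z) (lamK_nonneg z)).trans (lamK_mul_sq_le hB₂ z)
      have h3 : 0 ≤ 4 * B₀ * lamKTrunc (1 / 2) z := by have := lamKTrunc_nonneg (1 / 2) z; positivity
      linarith
    · rw [indicator_of_notMem hz, zero_add]
      have hz1 : 1 ≤ ‖z‖ := by simpa [mem_ball, dist_zero_right] using hz
      have hK : lamKTrunc (1 / 2) z = lamK z := lamKTrunc_of_lt (by linarith)
      have hD : ‖(2 : ℝ) • φ x - φ (x + z) - φ (x - z)‖ ≤ 4 * B₀ := by
        calc ‖(2 : ℝ) • φ x - φ (x + z) - φ (x - z)‖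
            ≤ ‖(2 : ℝ) • φ x‖ + ‖φ (x + z)‖ + ‖φ (x - z)‖ := by
              calc _ ≤ ‖(2 : ℝ) • φ x - φ (x + z)‖ + ‖φ (x - z)‖ := norm_sub_le _ _
                _ ≤ _ := by gcongr; exact norm_sub_le _ _
          _ ≤ 2 * B₀ + B₀ + B₀ := by
              rw [norm_smul, Real.norm_eq_abs, abs_of_pos (by norm_num : (0 : ℝ) < 2)]
              gcongr <;> exact h0 _
          _ = 4 * B₀ := by ring
      calc lamK z * ‖(2 : ℝ) • φ x - φ (x + z) - φ (x - z)‖ ≤ lamK z * (4 * B₀) :=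
            mul_le_mul_of_nonneg_left hD (lamK_nonneg z)
        _ = 4 * B₀ * lamKTrunc (1 / 2) z := by rw [hK]; ring

/-! ### Differentiation under the integral sign -/

section Commute

variable {f : EuclideanSpace ℝ (Fin 3) → EuclideanSpace ℝ (Fin 3)} {M₀ M₁ M₂ M₃ : ℝ}

/-- Conversions between the curried iterated derivatives and `iteratedFDeriv`. -/
theorem norm_fderiv_two_le (hf2 : ∀ x, ‖iteratedFDeriv ℝ 2 f x‖ ≤ M₂) (y : EuclideanSpace ℝ (Fin 3)) :
    ‖fderiv ℝ (fderiv ℝ f) y‖ ≤ M₂ := by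
  rw [← norm_iteratedFDeriv_one (𝕜 := ℝ) (fderiv ℝ f), norm_iteratedFDeriv_fderiv]; exact hf2 y

/-- Second derivatives of the evaluations `x ↦ Df(x) v` are bounded by `‖D³f‖ ‖v‖` (stated through `iteratedFDeriv`,
avoiding triply nested operator spaces). -/
theorem norm_fderiv_fderiv_apply_le (hf : ContDiff ℝ 3 f) (hf3 : ∀ x, ‖iteratedFDeriv ℝ 3 f x‖ ≤ M₃)
    (v y : EuclideanSpace ℝ (Fin 3)) :
    ‖fderiv ℝ (fderiv ℝ (fun x => fderiv ℝ f x v)) y‖ ≤ M₃ * ‖v‖ := by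
  have hc : ContDiff ℝ 2 (fderiv ℝ f) := hf.fderiv_right (m := 2) (by norm_num)
  have hM₃ : 0 ≤ M₃ := (norm_nonneg _).trans (hf3 y)
  rw [← norm_iteratedFDeriv_one (𝕜 := ℝ) (fderiv ℝ (fun x => fderiv ℝ f x v)), norm_iteratedFDeriv_fderiv]
  refine ContinuousMultilinearMap.opNorm_le_bound (by positivity) fun m => ?_
  rw [iteratedFDeriv_clm_apply_const_apply hc (le_refl _)]
  calc ‖(iteratedFDeriv ℝ 2 (fderiv ℝ f) y m) v‖ ≤ ‖iteratedFDeriv ℝ 2 (fderiv ℝ f) y m‖ * ‖v‖ :=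
        ContinuousLinearMap.le_opNorm _ _
    _ ≤ (‖iteratedFDeriv ℝ 2 (fderiv ℝ f) y‖ * ∏ i, ‖m i‖) * ‖v‖ := by
        gcongr; exact ContinuousMultilinearMap.le_opNorm _ _
    _ ≤ (M₃ * ∏ i, ‖m i‖) * ‖v‖ := by
        gcongr
        rw [norm_iteratedFDeriv_fderiv]; exact hf3 y
    _ = M₃ * ‖v‖ * ∏ i, ‖m i‖ := by ring

/-- **Second differences of `Df` are quadratic**: `‖2Df(x) − Df(x+z) − Df(x−z)‖ ≤ 2‖D³f‖_∞ ‖z‖²` (mean value twice on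
each evaluation `x ↦ Df(x) v`, then the operator-norm bound). -/
theorem norm_secondDiff_fderiv_le (hf : ContDiff ℝ 3 f) (hf3 : ∀ x, ‖iteratedFDeriv ℝ 3 f x‖ ≤ M₃)
    (x z : EuclideanSpace ℝ (Fin 3)) :
    ‖(2 : ℝ) • fderiv ℝ f x - fderiv ℝ f (x + z) - fderiv ℝ f (x - z)‖ ≤ 2 * M₃ * ‖z‖ ^ 2 := by
  have hM₃ : 0 ≤ M₃ := (norm_nonneg _).trans (hf3 x)
  refine ContinuousLinearMap.opNorm_le_bound _ (by positivity) fun v => ?_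
  have hφ : ContDiff ℝ 2 (fun x => fderiv ℝ f x v) :=
    (hf.fderiv_right (m := 2) (by norm_num)).clm_apply contDiff_const
  have h := norm_secondDiff_le hφ (norm_fderiv_fderiv_apply_le hf hf3 v) x z
  rw [sub_apply, sub_apply, smul_apply]
  calc ‖(2 : ℝ) • fderiv ℝ f x v - fderiv ℝ f (x + z) v - fderiv ℝ f (x - z) v‖ ≤ 2 * (M₃ * ‖v‖) * ‖z‖ ^ 2 := h
    _ = 2 * M₃ * ‖z‖ ^ 2 * ‖v‖ := by ring

/-- **`Λ f` is differentiable, with `D(Λ f)(x) = ½ ∫ lamK z • (2Df(x) − Df(x+z) − Df(x−z)) dz`** (differentiation under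
the integral sign; `f ∈ C³` with bounded derivatives of orders `0, 1, 2, 3`). -/
theorem hasFDerivAt_fracLapHalf (hf : ContDiff ℝ 3 f) (hf0 : ∀ x, ‖f x‖ ≤ M₀) (hf1 : ∀ x, ‖fderiv ℝ f x‖ ≤ M₁)
    (hf2 : ∀ x, ‖iteratedFDeriv ℝ 2 f x‖ ≤ M₂) (hf3 : ∀ x, ‖iteratedFDeriv ℝ 3 f x‖ ≤ M₃)
    (x₀ : EuclideanSpace ℝ (Fin 3)) :
    Integrable (fun z => lamK z • ((2 : ℝ) • fderiv ℝ f x₀ - fderiv ℝ f (x₀ + z) - fderiv ℝ f (x₀ - z))) ∧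
    HasFDerivAt (fracLapHalf f)
      ((1 / 2 : ℝ) • ∫ z, lamK z • ((2 : ℝ) • fderiv ℝ f x₀ - fderiv ℝ f (x₀ + z) - fderiv ℝ f (x₀ - z))) x₀ := by
  have hd : Differentiable ℝ f := hf.differentiable (by norm_num)
  have hDc : Continuous (fderiv ℝ f) := hf.continuous_fderiv (by norm_num)
  -- second differences of `f` and of `Df`
  have hS0 : ∀ x z, ‖(2 : ℝ) • f x - f (x + z) - f (x - z)‖ ≤ 2 * M₂ * ‖z‖ ^ 2 := fun x z =>
    norm_secondDiff_le (hf.of_le (by norm_num)) (norm_fderiv_two_le hf2) x z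
  have hS1 : ∀ x z, ‖(2 : ℝ) • fderiv ℝ f x - fderiv ℝ f (x + z) - fderiv ℝ f (x - z)‖ ≤ 2 * M₃ * ‖z‖ ^ 2 :=
    fun x z => norm_secondDiff_fderiv_le hf hf3 x z
  obtain ⟨g, hgi, hg⟩ := exists_majorant_secondDiff_general hf1 hS1
  -- the data of the parametric-integral theorem
  set F : EuclideanSpace ℝ (Fin 3) → EuclideanSpace ℝ (Fin 3) → EuclideanSpace ℝ (Fin 3) :=
    fun x z => lamK z • ((2 : ℝ) • f x - f (x + z) - f (x - z)) with hF
  set F' : EuclideanSpace ℝ (Fin 3) → EuclideanSpace ℝ (Fin 3) →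
      (EuclideanSpace ℝ (Fin 3) →L[ℝ] EuclideanSpace ℝ (Fin 3)) :=
    fun x z => lamK z • ((2 : ℝ) • fderiv ℝ f x - fderiv ℝ f (x + z) - fderiv ℝ f (x - z)) with hF'
  have hF_meas : ∀ x, AEStronglyMeasurable (F x) volume := fun x =>
    (measurable_lamK.smul
      (by fun_prop : Continuous fun z => (2 : ℝ) • f x - f (x + z) - f (x - z)).measurable).aestronglyMeasurable
  have hF'_meas : ∀ x, AEStronglyMeasurable (F' x) volume := fun x => by
    have hc : Continuous fun z => (2 : ℝ) • fderiv ℝ f x - fderiv ℝ f (x + z) - fderiv ℝ f (x - z) := by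
      fun_prop
    exact measurable_lamK.aestronglyMeasurable.smul hc.aestronglyMeasurable
  have hF_int : Integrable (F x₀) := integrable_fracLapHalf_integrand hf.continuous hf0 hS0 x₀
  have h_bound : ∀ᵐ z ∂(volume : Measure (EuclideanSpace ℝ (Fin 3))), ∀ x ∈ (univ : Set (EuclideanSpace ℝ (Fin 3))),
      ‖F' x z‖ ≤ g z := ae_of_all _ fun z x _ => by
    rw [hF']; dsimp only
    rw [norm_smul, Real.norm_eq_abs, abs_of_nonneg (lamK_nonneg z)]
    exact hg x z
  have h_diff : ∀ᵐ z ∂(volume : Measure (EuclideanSpace ℝ (Fin 3))), ∀ x ∈ (univ : Set (EuclideanSpace ℝ (Fin 3))),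
      HasFDerivAt (F · z) (F' x z) x := ae_of_all _ fun z x _ => by
    rw [hF, hF']
    have h1 : HasFDerivAt (fun x => f (x + z)) (fderiv ℝ f (x + z)) x := by
      have := (hd (x + z)).hasFDerivAt.comp x ((hasFDerivAt_id x).add_const z)
      simpa [Function.comp_def] using this
    have h2 : HasFDerivAt (fun x => f (x - z)) (fderiv ℝ f (x - z)) x := by
      have := (hd (x - z)).hasFDerivAt.comp x ((hasFDerivAt_id x).sub_const z)
      simpa [Function.comp_def] using this
    have h3 := (hd x).hasFDerivAt.const_smul (2 : ℝ)
    exact ((h3.sub h1).sub h2).const_smul (lamK z)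
  have hmain := hasFDerivAt_integral_of_dominated_of_fderiv_le (μ := volume) (F := F) (F' := F') (x₀ := x₀)
    (s := univ) Filter.univ_mem (Eventually.of_forall hF_meas) hF_int (hF'_meas x₀) h_bound hgi h_diff
  have hint' : Integrable (F' x₀) := hgi.mono' (hF'_meas x₀) (ae_of_all _ fun z => by
    rw [hF']; dsimp only
    rw [norm_smul, Real.norm_eq_abs, abs_of_nonneg (lamK_nonneg z)]
    exact hg x₀ z)
  refine ⟨hint', ?_⟩
  have h := hmain.const_smul (1 / 2 : ℝ)
  exact h

/-- **`curl` commutes with `Λ`**: `curl (Λ f) x = Λ (curl f) x` for `f ∈ C³` with bounded derivatives of orders `0…3`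
(`curl = curlCLM ∘ D`, and `curlCLM` passes through the Bochner integral). -/
theorem curl_fracLapHalf (hf : ContDiff ℝ 3 f) (hf0 : ∀ x, ‖f x‖ ≤ M₀) (hf1 : ∀ x, ‖fderiv ℝ f x‖ ≤ M₁)
    (hf2 : ∀ x, ‖iteratedFDeriv ℝ 2 f x‖ ≤ M₂) (hf3 : ∀ x, ‖iteratedFDeriv ℝ 3 f x‖ ≤ M₃)
    (x : EuclideanSpace ℝ (Fin 3)) :
    curl (fracLapHalf f) x = fracLapHalf (curl f) x := by
  obtain ⟨hint, hder⟩ := hasFDerivAt_fracLapHalf hf hf0 hf1 hf2 hf3 x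
  rw [curl_eq_curlCLM, hder.fderiv, map_smul, ← ContinuousLinearMap.integral_comp_comm curlCLM hint]
  unfold fracLapHalf
  congr 1
  refine integral_congr_ae (Eventually.of_forall fun z => ?_)
  simp only [map_smul, map_sub, curl_eq_curlCLM]

/-- **The vorticity of a chiral field is chiral**: if `curl v = Λ v` everywhere (`IsChiral v`) and `v ∈ C³` with
bounded derivatives of orders `0…3`, then `curl (curl v) = Λ (curl v)` everywhere (`IsChiral (curl v)`). -/
theorem isChiral_curl {v : EuclideanSpace ℝ (Fin 3) → EuclideanSpace ℝ (Fin 3)} {M₀ M₁ M₂ M₃ : ℝ}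
    (hv : ContDiff ℝ 3 v) (hv0 : ∀ x, ‖v x‖ ≤ M₀) (hv1 : ∀ x, ‖fderiv ℝ v x‖ ≤ M₁)
    (hv2 : ∀ x, ‖iteratedFDeriv ℝ 2 v x‖ ≤ M₂) (hv3 : ∀ x, ‖iteratedFDeriv ℝ 3 v x‖ ≤ M₃) (hchi : IsChiral v) :
    IsChiral (curl v) := by
  intro x
  have hfun : curl v = fracLapHalf v := funext hchi
  conv_lhs => rw [hfun]
  exact curl_fracLapHalf hv hv0 hv1 hv2 hv3 x

end Commute

end Summit.NavierStokesRegularity.NavierStokesRegularity.Theorems.ChiralWindowDoorCurlCommutes
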